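import Literature.AnabelianGeometry.EtaleTheta.ThetaSectionsOfSetting
import Literature.AnabelianGeometry.EtaleTheta.ThetaCohomology
import Literature.AnabelianGeometry.EtaleTheta.GKCenterFree
import HarnessLib

/-!
# [EtTh] §2 over §1: the rigidity interface `RigidData N l` of `X̲̲`, built from the §1 theta setting
# (merge adapter, part 3)

Mochizuki, *The étale theta function …*, Publ. RIMS **45** (2009), §2, PRIMS PDF pages (printed = PDF + 226):
Prop. 2.12 p. 45 [cite: MochizukiEtTh2009, Prop 2.12 p.45], "the natural isomorphism `μ_N ≅ (l·Δ_Θ) ⊗ (ℤ/Nℤ)`"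
p. 46 [cite: MochizukiEtTh2009, Def 2.13 p.46], Cor. 2.18 p. 59 [cite: MochizukiEtTh2009, Cor 2.18 p.59], the cusp
labels of Cor. 2.9 p. 43 [cite: MochizukiEtTh2009, Cor 2.9 p.43] (one locator per printed item; v3 doc-only rev
of the bundled citation, referee finding D6-F3). Layer L2 of the abc-iut cell,
wave-2 unit W2-L2-04, seat abc-iut-L2-t8. Continuation of `ThetaEnvOfSetting.lean`.

The interface `RigidData N l` of `ThetaRigidity.lean` (seat abc-iut-L2-t2; TODO-merge(abc-iut-L2-t1))
adds to `ThetaEnvData N` the theta subquotients "`(l·Δ_Θ) ⊆ (Δ^tp_Y)^Θ ⊆ (Π^tp_Y)^Θ` of `Π^tp_X̲̲`"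
(p. 45, Prop. 2.12, Cor. 2.18 (i)) through their inverse images, the identification
"`(l·Δ_Θ) ↠ (l·Δ_Θ) ⊗ ℤ/Nℤ ≅ μ_N`" (p. 46), two compatibilities of the theta cocycles with them, and the
labelled cusps (Cor. 2.9, p. 43). Here, over the §1 root `D : ThetaSetting` (seat abc-iut-L2-t1):

* `thetaKer := Ker(Π^tp_X̲̲ → (Π^tp_X)^Θ)`, `lDeltaTheta :=` the inverse image of `ThetaSetting.lDeltaTheta`,
  `thetaMod :=` the composite with `CyclotomeMod.red` — DEFINED; the axioms `thetaKer_le`,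
  `lDeltaTheta_le`, normality, `thetaMod_surjective`, `thetaMod_ker`, `thetaMod_conj` — PROVED;
* `cocycle_thetaKer`, `cocycle_lDeltaTheta` ("the theta and algebraic sections coincide over
  `Ker(Π_Y ↠ (Π_Y)^Θ)` [cf. Proposition 1.3]", p. 66; "the étale theta class determines an isomorphism
  between `Δ_Θ` and the coefficients", Rmk. 2.19.2) — PROVED from abc-iut-L2-t1's named fact
  `ThetaSetting.Prop15iii` ([EtTh] Prop. 1.5 (iii): `η̈^Θ` restricts to `log(Θ)` on `Δ_Θ`), at the level
  of cocycles (`etaDd_cocycle_apply`, `rootCocycle_apply`);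
* the cusp labels `∈ ℤ`, `∈ (ℤ/lℤ)^±` (p. 42) have no carrier in the §1 typing (`Setting.Dcusp` has no
  axioms; the labels come from the irreducible components of the special fibre, i.e. the dual graph
  owned by abc-iut-L3-t2) and enter as the INPUT `CuspLabels` — TODO-merge(abc-iut-L2-t1/L3-t2).

HONEST FRAMING: [EtTh] is refereed; `Prop15iii` is a named (unproved) fact of §1, so `rigidData` is
CONDITIONAL on it; nothing else is asserted; no side is taken on any disputed claim.
-/

noncomputable section

namespace Literature.AnabelianGeometry.EtaleTheta

open Literature.AnabelianGeometry.SemiGraphs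

namespace ThetaSetting

variable {p : ℕ} [Fact p.Prime] {D : ThetaSetting p} {E : D.EtaleThetaData}

/-! ### Prop. 1.5 (iii) at the level of cocycles: `η̈^Θ` is tautological on the inverse image of `Δ_Θ` -/

/-- A coboundary vanishes where the acting element lies in `Δ_Θ` (`Δ_Θ` is commutative).
[cite: MochizukiEtTh2009, Prop 1.5 (iii) p.23] -/
theorem conjNormal_mul_inv_eq_one {t : D.GtpTheta} (ht : t ∈ D.DeltaTheta) (c : D.DeltaTheta) :
    MulAut.conjNormal t c * c⁻¹ = 1 := by
  apply Subtype.ext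
  rw [Subgroup.coe_mul, MulAut.conjNormal_apply, Subgroup.coe_inv, Subgroup.coe_one,
    D.ker_thetaToEll_comm t ht c c.2, mul_inv_cancel_right, mul_inv_cancel]

/-- **Prop. 1.5 (iii) for cocycles**: from abc-iut-L2-t1's named fact `Prop15iii` ("`η̈^Θ` arises from a
unique class `∈ H¹((Π^tp_Ÿ)^Θ, Δ_Θ)` that maps to `log(Θ)` in `F̈⁰/F̈¹`", p. 23), EVERY continuous cocycle
representing `η̈^Θ ∈ H¹(Π^tp_Ÿ, Δ_Θ)` restricts on the inverse image of `Δ_Θ` in `Π^tp_Ÿ` to the tautological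
map `k ↦ (image of k in (Π^tp_X)^Θ)` — PROVED (coboundaries die there).
[cite: MochizukiEtTh2009, Prop 1.5 (iii) p.23] -/
theorem etaDd_cocycle_apply (hC : D.Compat) (h15 : Prop15iii E hC)
    (f₀ : contCocycles D.toTheta D.DeltaTheta D.GtpYdd) (hf₀ : ContH1.mk f₀.1 f₀.2 = E.etaDd)
    (k : D.GtpYdd) (hk : D.toTheta (k : D.PiTemp) ∈ D.DeltaTheta) :
    (f₀.1 k : D.GtpTheta) = D.toTheta (k : D.PiTemp) := by
  have hmem : E.etaDd ∈ E.thetaClasses := ⟨1, one_mem _, (one_mul _).symm⟩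
  obtain ⟨x', ⟨hx'1, hx'2, -⟩, -⟩ := h15 E.etaDd hmem
  obtain ⟨f', rfl⟩ : ∃ f' : contCocycles (MonoidHom.id D.GtpTheta) D.DeltaTheta
      (D.GtpYdd.map D.toTheta), (QuotientGroup.mk f' : D.H1Theta (D.GtpYdd.map D.toTheta)) = x' :=
    QuotientGroup.mk_surjective x'
  -- (1) `f₀ = infl f' · ∂c`
  have e1 : (QuotientGroup.mk (ContH1.inflCocycle D.DeltaTheta D.toTheta D.continuous_toTheta
      le_rfl f') : D.H1 D.GtpYdd) = QuotientGroup.mk f₀ := hx'1.trans hf₀.symm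
  rw [QuotientGroup.eq, Subgroup.mem_subgroupOf, mem_contCoboundaries_iff] at e1
  obtain ⟨c, hc⟩ := e1
  have hc' := congrFun hc k
  rw [conjNormal_mul_inv_eq_one hk] at hc'
  -- hc' : ((infl f')⁻¹ * f₀) k = 1
  have hk1 : f₀.1 k = (ContH1.inflCocycle D.DeltaTheta D.toTheta D.continuous_toTheta le_rfl f').1 k :=
    by
    have : ((ContH1.inflCocycle D.DeltaTheta D.toTheta D.continuous_toTheta le_rfl f').1 k)⁻¹ *
        f₀.1 k = 1 := hc'
    rwa [inv_mul_eq_one, eq_comm] at this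
  -- (2) `res f' = id · ∂c'` on `Δ_Θ`
  have e2 : (QuotientGroup.mk (ContH1.resCocycle (MonoidHom.id D.GtpTheta) D.DeltaTheta
      (hC.deltaTheta_le_DtpYddTheta.trans (Subgroup.map_mono inf_le_left)) f') :
        D.H1Theta D.DeltaTheta) = D.logTheta := hx'2
  change _ = (QuotientGroup.mk _ : D.H1Theta D.DeltaTheta) at e2
  rw [QuotientGroup.eq, Subgroup.mem_subgroupOf, mem_contCoboundaries_iff] at e2
  obtain ⟨c', hc2⟩ := e2
  have hc2' := congrFun hc2 ⟨D.toTheta (k : D.PiTemp), hk⟩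
  rw [conjNormal_mul_inv_eq_one (by exact hk)] at hc2'
  have hk2 : f'.1 ⟨D.toTheta (k : D.PiTemp),
      (hC.deltaTheta_le_DtpYddTheta.trans (Subgroup.map_mono inf_le_left)) hk⟩ =
        ⟨D.toTheta (k : D.PiTemp), hk⟩ := by
    have : (f'.1 ⟨D.toTheta (k : D.PiTemp),
        (hC.deltaTheta_le_DtpYddTheta.trans (Subgroup.map_mono inf_le_left)) hk⟩)⁻¹ *
          ⟨D.toTheta (k : D.PiTemp), hk⟩ = 1 := hc2'
    rwa [inv_mul_eq_one] at this
  rw [hk1]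
  exact congrArg Subtype.val hk2

namespace EtaleThetaData.DoubleUnderline

variable {l : ℕ} (C : E.DoubleUnderline l) {N : ℕ+} (μ : D.CyclotomeMod l N)

/-- **The root cocycles are tautological on the inverse image of `Δ_Θ`**: every cocycle of
`η̲̈^{Θ,l·ℤ×μ₂}` (a `Π^tp_X̲̲`-conjugate of `η̈^Θ|_{Π^tp_Ÿ̲̲}` up to coboundary) sends `k ∈ Π^tp_Ÿ̲̲` with image in
`Δ_Θ` to that image — the cocycle form of "the étale theta class determines an isomorphism between
`Δ_Θ` and the coefficients" (Rmk. 2.19.2, via Prop. 1.5 (iii)); PROVED from `Prop15iii`.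
[cite: MochizukiEtTh2009, Cor 2.19 (i) p.64] -/
theorem rootCocycle_apply (hC : D.Compat) (h15 : Prop15iii E hC)
    {f : contCocycles D.toTheta D.DeltaTheta C.GtpYdduu} (hf : f ∈ C.rootCocycles hC)
    (k : C.GtpYdduu) (hk : D.toTheta (k : D.PiTemp) ∈ D.DeltaTheta) :
    (f.1 k : D.GtpTheta) = D.toTheta (k : D.PiTemp) := by
  haveI := hC.GtpYdd_normal
  obtain ⟨σ, hσ, hclass⟩ := hf.2
  obtain ⟨f₀, hf₀⟩ : ∃ f₀ : contCocycles D.toTheta D.DeltaTheta D.GtpYdd,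
      (QuotientGroup.mk f₀ : D.H1 D.GtpYdd) = E.etaDd := QuotientGroup.mk_surjective _
  have e1 : (QuotientGroup.mk (ContH1.resCocycle D.toTheta D.DeltaTheta
      (inf_le_left : C.GtpYdduu ≤ D.GtpYdd) (ContH1.conjCocycle D.toTheta D.DeltaTheta σ f₀)) :
        D.H1 C.GtpYdduu) = QuotientGroup.mk f := by
    rw [← hf₀] at hclass
    exact hclass.symm
  rw [QuotientGroup.eq, Subgroup.mem_subgroupOf, mem_contCoboundaries_iff] at e1
  obtain ⟨c, hc⟩ := e1
  have hc' := congrFun hc k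
  rw [conjNormal_mul_inv_eq_one hk] at hc'
  have hk1 : f.1 k = (ContH1.resCocycle D.toTheta D.DeltaTheta
      (inf_le_left : C.GtpYdduu ≤ D.GtpYdd) (ContH1.conjCocycle D.toTheta D.DeltaTheta σ f₀)).1 k := by
    have : ((ContH1.resCocycle D.toTheta D.DeltaTheta (inf_le_left : C.GtpYdduu ≤ D.GtpYdd)
        (ContH1.conjCocycle D.toTheta D.DeltaTheta σ f₀)).1 k)⁻¹ * f.1 k = 1 := hc'
    rwa [inv_mul_eq_one, eq_comm] at this
  rw [hk1]
  -- the conjugate cocycle at `k`: `toTheta σ · f₀(σ⁻¹ k σ) · toTheta σ⁻¹`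
  change ((MulAut.conjNormal (D.toTheta σ) (f₀.1 (MulAut.conjNormal σ⁻¹ ⟨(k : D.PiTemp), k.2.1⟩)) :
    D.DeltaTheta) : D.GtpTheta) = _
  have hkσ : D.toTheta ((MulAut.conjNormal σ⁻¹ (⟨(k : D.PiTemp), k.2.1⟩ : D.GtpYdd) : D.GtpYdd) :
      D.PiTemp) ∈ D.DeltaTheta := by
    have h1 := D.deltaTheta_normal.conj_mem _ hk (D.toTheta σ⁻¹)
    simpa only [MulAut.conjNormal_apply, MulAut.conjNormal_inv_apply, map_mul, map_inv, inv_inv]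
      using h1
  rw [MulAut.conjNormal_apply, etaDd_cocycle_apply hC h15 f₀ hf₀ _ hkσ, MulAut.conjNormal_apply,
    inv_inv, map_mul, map_mul, map_inv]
  group

/-! ### Where the theta subquotients sit -/

/-- Elements of `Π^tp_X` whose image in `(Π^tp_X)^Θ` lies in `Δ_Θ` belong to `Δ^tp_Ÿ = Π^tp_Ÿ ∩ Δ^tp_X`
("`Δ_Θ ⊆ (Δ^tp_Ÿ)^Θ`", Prop. 1.5 (ii), p. 23; `Π^tp_Ÿ = Π^tp_{Y₂} ⊇ Ker(Π^tp_Y ↠ (Π^tp_Y)^ell)`, p. 13).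
[cite: MochizukiEtTh2009, Prop 2.14 (i) p.49] -/
theorem mem_GtpYdd_of_toTheta_mem (hS : D.Sec2Hyps) {x : D.PiTemp}
    (hx : D.toTheta x ∈ D.DeltaTheta) : x ∈ D.GtpYdd ∧ x ∈ D.DeltaTemp := by
  have hker : x ∈ (D.thetaToEll.comp D.toTheta).ker := by
    rw [MonoidHom.mem_ker, MonoidHom.coe_comp, Function.comp_apply]
    exact hx
  have hY : x ∈ D.GtpY := D.ker_toEll_le_GtpY hker
  refine ⟨?_, D.ker_toEll_le_deltaTemp hker⟩
  rw [GtpYdd_eq_GtpYN_two hS]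
  exact hS.ker_toEll_le_GtpYN 2 ⟨hker, hY⟩

/-! ### The labelled cusps (input) -/

/-- **The labelled cusps of `X̲̲` and `Y̲̲`** (p. 42: "labels `∈ ℤ` for the cusps of `Y`", "labels for the
cusps … may be thought of as well-defined elements of `(ℤ/lℤ)^±`"; Cor. 2.9, p. 43): label ↦ cuspidal
decomposition groups. INPUT DATA — the §1 typing has no carrier for them (`Setting.Dcusp` has no axioms;
the labels are read off the irreducible components of the special fibre of `Y`, p. 42, i.e. the dual
graph); TODO-merge(abc-iut-L2-t1/abc-iut-L3-t2). [cite: MochizukiEtTh2009, Cor 2.9 p.43] -/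
structure CuspLabels : Type where
  /-- cusps of `Y̲̲` labelled by `ℤ`: label ↦ cuspidal decomposition groups in `Π^tp_Y̲̲` (p. 42) -/
  cuspY : ℤ → Set (Subgroup (D.GtpY.subgroupOf C.Huu))
  /-- cusps of `X̲̲` labelled by `(ℤ/lℤ)^±`: label ↦ cuspidal decomposition groups in `Π^tp_X̲̲` (p. 43) … -/
  cuspX : ZMod l → Set (Subgroup C.Huu)
  /-- … depending only on the class in `(ℤ/lℤ)^± = (ℤ/lℤ)/{±1}` (p. 43) -/
  cuspX_neg : ∀ a, cuspX (-a) = cuspX a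

/-! ### The rigidity data `RigidData N l` of `X̲̲` -/

/-- **[EtTh] §2's rigidity interface for `X̲̲`, INSTANTIATED from §1** (conditional on abc-iut-L2-t1's
named fact `Prop15iii`, used only for the two cocycle compatibilities): `RigidData N l` of
`ThetaRigidity.lean` over `C.thetaEnvData`, with `thetaKer := Ker(Π^tp_X̲̲ → (Π^tp_X)^Θ)`,
`lDeltaTheta :=` the inverse image of `l·Δ_Θ`, `thetaMod := (l·Δ_Θ) ↠ μ_N` composed with the theta
quotient, and the input cusp labels; the axioms `thetaKer_le`, `lDeltaTheta_le`, `thetaMod_surjective`,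
`thetaMod_ker` ("`(l·Δ_Θ) ≅ Ẑ(1)` is torsion-free procyclic", here: kernel of `red` = `N`-th powers),
`thetaMod_conj`, `cocycle_thetaKer`, `cocycle_lDeltaTheta`, `augYdd_surjective` (`Π^tp_Ÿ̲̲ ↠ G_K`) and
`thetaSections_conj` (all theta sections are `K^×, (l·ℤ)`-conjugate: `ThetaSectionsOfSetting.lean`) are
PROVED. Resolves TODO-merge(abc-iut-L2-t1) of `RigidData` up to the cusp labels.
[cite: MochizukiEtTh2009, Cor 2.18 p.59] -/
abbrev rigidData (hC : D.Compat) (hS : D.Sec2Hyps) (h15 : Prop15iii E hC) (L : C.CuspLabels) :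
    RigidData.{0} N l where
  toThetaEnvData := C.thetaEnvData μ hC hS
  thetaKer := (D.toTheta.comp C.Huu.subtype).ker
  thetaKer_normal := inferInstance
  thetaKer_le := by
    intro x hx
    rw [MonoidHom.mem_ker, MonoidHom.coe_comp, Function.comp_apply, Subgroup.coe_subtype] at hx
    have h := mem_GtpYdd_of_toTheta_mem hS (x := (x : D.PiTemp)) (by rw [hx]; exact one_mem _)
    refine ⟨Subgroup.mem_subgroupOf.2 h.1, ?_⟩
    change x ∈ ((D.aug.toMonoidHom.comp C.Huu.subtype).codRestrict D.GK
      fun x => D.aug_mem_GK (x : D.PiTemp)).ker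
    rw [MonoidHom.ker_codRestrict, MonoidHom.mem_ker, MonoidHom.coe_comp, Function.comp_apply,
      Subgroup.coe_subtype]
    exact h.2
  lDeltaTheta := (D.lDeltaTheta l).comap (D.toTheta.comp C.Huu.subtype)
  thetaKer_le_lDeltaTheta := by
    intro x hx
    rw [MonoidHom.mem_ker] at hx
    rw [Subgroup.mem_comap, hx]
    exact one_mem _
  lDeltaTheta_le := by
    intro x hx
    rw [Subgroup.mem_comap, MonoidHom.coe_comp, Function.comp_apply, Subgroup.coe_subtype] at hx
    have h := mem_GtpYdd_of_toTheta_mem hS (D.lDeltaTheta_le l hx)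
    refine ⟨Subgroup.mem_subgroupOf.2 h.1, ?_⟩
    change x ∈ ((D.aug.toMonoidHom.comp C.Huu.subtype).codRestrict D.GK
      fun x => D.aug_mem_GK (x : D.PiTemp)).ker
    rw [MonoidHom.ker_codRestrict, MonoidHom.mem_ker, MonoidHom.coe_comp, Function.comp_apply,
      Subgroup.coe_subtype]
    exact h.2
  lDeltaTheta_normal := (D.lDeltaTheta_normal l).comap _
  thetaMod := μ.red.comp C.toLDelta
  thetaMod_surjective := by
    intro m
    obtain ⟨a, rfl⟩ := μ.red_surjective m
    have ha : (a : D.GtpTheta) ∈ C.Huu.map D.toTheta ⊓ D.DeltaTheta := by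
      rw [C.map_toTheta_Huu]; exact a.2
    obtain ⟨⟨h, hh, hha⟩, -⟩ := ha
    refine ⟨⟨⟨h, hh⟩, ?_⟩, ?_⟩
    · rw [Subgroup.mem_comap, MonoidHom.coe_comp, Function.comp_apply, Subgroup.coe_subtype, hha]
      exact a.2
    · rw [MonoidHom.coe_comp, Function.comp_apply]
      congr 1
      exact Subtype.ext hha
  thetaMod_ker := by
    intro g
    rw [MonoidHom.coe_comp, Function.comp_apply, μ.red_ker]
    constructor
    · rintro ⟨y, hy⟩
      have hy' : (y : D.GtpTheta) ∈ C.Huu.map D.toTheta ⊓ D.DeltaTheta := by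
        rw [C.map_toTheta_Huu]; exact y.2
      obtain ⟨⟨h₀, hh₀, hh₀y⟩, -⟩ := hy'
      have hmem : (⟨h₀, hh₀⟩ : C.Huu) ∈ (D.lDeltaTheta l).comap (D.toTheta.comp C.Huu.subtype) := by
        rw [Subgroup.mem_comap, MonoidHom.coe_comp, Function.comp_apply, Subgroup.coe_subtype, hh₀y]
        exact y.2
      have hval : D.toTheta ((g : C.Huu) : D.PiTemp) = D.toTheta h₀ ^ (N : ℕ) := by
        have := congrArg Subtype.val hy
        rw [coe_toLDelta, SubmonoidClass.coe_pow] at this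
        rw [this, hh₀y]
      refine ⟨(g : C.Huu) * ((⟨h₀, hh₀⟩ : C.Huu) ^ (N : ℕ))⁻¹, ?_, ⟨⟨h₀, hh₀⟩, hmem⟩, ?_⟩
      · rw [MonoidHom.mem_ker, map_mul, map_inv, map_pow, MonoidHom.coe_comp, Function.comp_apply,
          Subgroup.coe_subtype, hval]
        exact mul_inv_cancel _
      · simp only [inv_mul_cancel_right]
    · rintro ⟨k, hk, h, hgk⟩
      refine ⟨C.toLDelta h, Subtype.ext ?_⟩
      rw [MonoidHom.mem_ker] at hk
      rw [coe_toLDelta, SubmonoidClass.coe_pow, coe_toLDelta]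
      have : (g : C.Huu) = k * (h : C.Huu) ^ (N : ℕ) := hgk
      rw [this, Subgroup.coe_mul, map_mul]
      change (D.toTheta.comp C.Huu.subtype) k * _ = _
      rw [hk, one_mul, SubmonoidClass.coe_pow, map_pow]
  thetaMod_conj := by
    intro x g
    change μ.red (C.toLDelta _) = galMuN p N (D.aug.toMonoidHom (x : D.PiTemp)) (μ.red (C.toLDelta g))
    rw [← μ.red_conj]
    congr 1
    apply Subtype.ext
    rw [coe_toLDelta]
    change D.toTheta ((x * (g : C.Huu) * x⁻¹ : C.Huu) : D.PiTemp) = _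
    rw [Subgroup.coe_mul, Subgroup.coe_mul, Subgroup.coe_inv, map_mul, map_mul, map_inv]
    rfl
  cocycle_thetaKer := by
    intro η hη g hg
    obtain ⟨f, hf, rfl⟩ := hη
    rw [MonoidHom.mem_ker, MonoidHom.coe_comp, Function.comp_apply, Subgroup.coe_subtype] at hg
    change μ.red ⟨(f.1 (C.inclYdduu g) : D.GtpTheta), hf.1 _⟩ = 1
    have hval : (f.1 (C.inclYdduu g) : D.GtpTheta) = 1 := by
      rw [C.rootCocycle_apply hC h15 hf (C.inclYdduu g) (by
        change D.toTheta ((g : C.Huu) : D.PiTemp) ∈ _; rw [hg]; exact one_mem _)]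
      exact hg
    have : (⟨(f.1 (C.inclYdduu g) : D.GtpTheta), hf.1 _⟩ : D.lDeltaTheta l) = 1 := Subtype.ext hval
    rw [this, map_one]
  cocycle_lDeltaTheta := by
    intro η hη g hg
    obtain ⟨f, hf, rfl⟩ := hη
    have hg' : D.toTheta ((g : C.Huu) : D.PiTemp) ∈ D.lDeltaTheta l := hg
    change μ.red ⟨(f.1 (C.inclYdduu g) : D.GtpTheta), hf.1 _⟩ = μ.red (C.toLDelta ⟨g, hg⟩)
    congr 1
    apply Subtype.ext
    rw [coe_toLDelta]
    exact C.rootCocycle_apply hC h15 hf (C.inclYdduu g) (D.lDeltaTheta_le l hg')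
  cuspY := L.cuspY
  cuspX := L.cuspX
  cuspX_neg := L.cuspX_neg
  augYdd_surjective γ := by
    obtain ⟨k, hk⟩ := C.exists_lift γ
    exact ⟨⟨⟨(k : D.PiTemp), (Subgroup.mem_inf.1 k.2).2⟩, (Subgroup.mem_inf.1 k.2).1⟩, Subtype.ext hk⟩
  thetaSections_conj η η' hη hη' := C.thetaSections_isKLConjugate μ hC hS hη hη'

/-- The instantiated rigidity data extend the instantiated environment data (definitional bookkeeping).
[cite: MochizukiEtTh2009, Cor 2.18 p.59] -/
theorem rigidData_toThetaEnvData (hC : D.Compat) (hS : D.Sec2Hyps) (h15 : Prop15iii E hC)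
    (L : C.CuspLabels) : (C.rigidData μ hC hS h15 L).toThetaEnvData = C.thetaEnvData μ hC hS := rfl

/-- On the instantiated data, t2's cyclotomic rigidity isomorphism of the MODEL (`sAlg · (sTheta)⁻¹ =
thetaMod` over `l·Δ_Θ`, `RigidData.sAlg_mul_sTheta_inv`, Cor. 2.19 (i)) is therefore a theorem about the
§1 objects. [cite: MochizukiEtTh2009, Cor 2.19 (i) p.64] -/
theorem sAlg_mul_sTheta_inv (hC : D.Compat) (hS : D.Sec2Hyps) (h15 : Prop15iii E hC)
    (L : C.CuspLabels) {η : (C.rigidData μ hC hS h15 L).PiYdd → MuN p N}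
    (hη : η ∈ (C.rigidData μ hC hS h15 L).thetaCocycles) (g : (C.rigidData μ hC hS h15 L).PiYdd)
    (hg : (g : C.Huu) ∈ (C.rigidData μ hC hS h15 L).lDeltaTheta) :
    (C.rigidData μ hC hS h15 L).toThetaEnvData.sAlg g *
        ((C.rigidData μ hC hS h15 L).toThetaEnvData.sTheta hη g)⁻¹ =
      CycEnvelope.inMu _ _ ((C.rigidData μ hC hS h15 L).thetaMod ⟨g, hg⟩) :=
  (C.rigidData μ hC hS h15 L).sAlg_mul_sTheta_inv hη g hg

/-! ### Two inputs of abc-iut-L2-t10's discharge of Prop. 2.14 (i) / Cor. 2.18 (iv) -/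

/-- **`Π^tp_Ÿ̲̲` and `Π^tp_Y̲̲` have the same image in `G_K`** (a gloss, not a quotation: the double covering
`Ÿ̲̲ → Y̲̲` of Def. 2.7 does not enlarge the base field, since `K̈ = K` under `Sec2Hyps`), in the form used by the
§2 discharge files (seat abc-iut-L2-t10, `(hYdd)`): every element of the image of `Π^tp_Y̲̲` in `G_K` is the
image of an element of `Π^tp_Ÿ̲̲` — PROVED (`map_aug_Ydduu`). (v3 doc-only rev: referee finding D6-F2 — the
earlier docstring put a non-printed word inside quotation marks.) [cite: MochizukiEtTh2009, Def 2.7 p.41] -/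
theorem exists_PiYdd_augY_eq (hC : D.Compat) (hS : D.Sec2Hyps) (h : (C.thetaEnvData μ hC hS).PiY) :
    ∃ d : (C.thetaEnvData μ hC hS).PiYdd,
      (C.thetaEnvData μ hC hS).augY ((C.thetaEnvData μ hC hS).inclYdd d) =
        (C.thetaEnvData μ hC hS).augY h := by
  obtain ⟨k, hk⟩ := C.exists_lift ⟨D.aug.toMonoidHom ((h : C.Huu) : D.PiTemp), D.aug_mem_GK _⟩
  refine ⟨⟨⟨(k : D.PiTemp), (Subgroup.mem_inf.1 k.2).2⟩, (Subgroup.mem_inf.1 k.2).1⟩, ?_⟩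
  exact Subtype.ext hk

/-- **"`G_K` is center-free"** ([AbsAnab] Thm. 1.1.1 (ii), quoted in the proof of Prop. 2.14 (i),
p. 50: "since `G_K` is center-free") in the form used by the §2 discharge files (seat abc-iut-L2-t10,
`(hslim)`): an element of `Π^tp_X̲̲` whose image in `G_K` commutes with the image of `Π^tp_Y̲̲` has trivial
image — PROVED from the center-freeness of `G_K ≤ G_{ℚ_p}` taken as a hypothesis (the tree's named fact
`AbsoluteAnabelian.galoisMLF_slim` states it for `Gal(K̄/K)`; its transport to `K.fixingSubgroup` is
not done here). [cite: MochizukiEtTh2009, Prop 2.14 (i) p.50] -/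
theorem aug_eq_one_of_forall_conj (hC : D.Compat) (hS : D.Sec2Hyps)
    (hZ : ∀ g ∈ D.GK, (∀ g' ∈ D.GK, g * g' = g' * g) → g = 1)
    (z : (C.thetaEnvData μ hC hS).PiX)
    (hz : ∀ y : (C.thetaEnvData μ hC hS).PiY,
      (C.thetaEnvData μ hC hS).aug (z * y * z⁻¹) = (C.thetaEnvData μ hC hS).aug y) :
    (C.thetaEnvData μ hC hS).aug z = 1 := by
  apply Subtype.ext
  refine hZ _ (D.aug_mem_GK _) fun g' hg' => ?_
  obtain ⟨k, hk⟩ := C.exists_lift ⟨g', hg'⟩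
  have hy := congrArg Subtype.val
    (hz ⟨⟨(k : D.PiTemp), (Subgroup.mem_inf.1 k.2).2⟩,
      D.GtpYdd_le_GtpY (Subgroup.mem_inf.1 k.2).1⟩)
  change D.aug.toMonoidHom ((z : C.Huu) * (k : D.PiTemp) * ((z : C.Huu) : D.PiTemp)⁻¹) =
    D.aug.toMonoidHom (k : D.PiTemp) at hy
  rw [map_mul, map_mul, map_inv, hk] at hy
  change D.aug.toMonoidHom ((z : C.Huu) : D.PiTemp) * g' * (D.aug.toMonoidHom ((z : C.Huu) : D.PiTemp))⁻¹ =
    g' at hy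
  change D.aug.toMonoidHom ((z : C.Huu) : D.PiTemp) * g' = g' * D.aug.toMonoidHom ((z : C.Huu) : D.PiTemp)
  calc D.aug.toMonoidHom ((z : C.Huu) : D.PiTemp) * g'
      = D.aug.toMonoidHom ((z : C.Huu) : D.PiTemp) * g' * (D.aug.toMonoidHom ((z : C.Huu) : D.PiTemp))⁻¹ *
          D.aug.toMonoidHom ((z : C.Huu) : D.PiTemp) := by group
    _ = g' * D.aug.toMonoidHom ((z : C.Huu) : D.PiTemp) := by rw [hy]

/-- `(hslim)` CONDITIONAL ONLY on the named fact "`Gal(K̄/K)` is slim" ([AbsAnab] Thm 1.1.1 (ii),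
`galoisMLF_slim`), via `ThetaSetting.GK_center_free`. [cite: MochizukiEtTh2009, Prop 2.14 (i) p.50] -/
theorem aug_eq_one_of_forall_conj_of_slim (hC : D.Compat) (hS : D.Sec2Hyps)
    (hslim : AbsoluteAnabelian.galoisMLF_slim) (z : (C.thetaEnvData μ hC hS).PiX)
    (hz : ∀ y : (C.thetaEnvData μ hC hS).PiY,
      (C.thetaEnvData μ hC hS).aug (z * y * z⁻¹) = (C.thetaEnvData μ hC hS).aug y) :
    (C.thetaEnvData μ hC hS).aug z = 1 :=
  C.aug_eq_one_of_forall_conj μ hC hS (D.GK_center_free hslim) z hz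

/-- The easy half of abc-iut-L2-t10's `(hcomm)`: a commutator `[z, b]` of elements of `Δ^tp_X̲̲`
(times an element of `Ker(Π^tp_X̲̲ → (Π^tp_X)^Θ)`) lies in the inverse image of `l·Δ_Θ` — its image is a
commutator of `Δ_X`, hence dies in `(Π^tp_X)^ell`, and lies in `(Π^tp_X̲̲)^Θ ∩ Δ_Θ = l·Δ_Θ`
(`map_toTheta_Huu`, Prop. 2.12 (i)). The converse ("every element of `l·Δ_Θ` is such a commutator")
is the Heisenberg structure of the theta group and is NOT derivable from the adapter's inputs.
[cite: MochizukiEtTh2009, Prop 2.12 (i) p.45] -/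
theorem commutator_mem_comap_lDeltaTheta (z b k : C.Huu) (hz : (z : D.PiTemp) ∈ D.DeltaTemp)
    (hb : (b : D.PiTemp) ∈ D.DeltaTemp) (hk : D.toTheta (k : D.PiTemp) = 1) :
    z * b * z⁻¹ * b⁻¹ * k ∈ (D.lDeltaTheta l).comap (D.toTheta.comp C.Huu.subtype) := by
  rw [Subgroup.mem_comap, MonoidHom.coe_comp, Function.comp_apply, Subgroup.coe_subtype,
    Subgroup.coe_mul, map_mul, hk, mul_one, ← C.map_toTheta_Huu]
  refine ⟨⟨_, (z * b * z⁻¹ * b⁻¹).2, rfl⟩, ?_⟩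
  -- `toTheta [z, b] ∈ Δ_Θ = Ker((Π^tp_X)^Θ ↠ (Π^tp_X)^ell)`: `[z, b] ∈ Ker(Π^tp_X ↠ (Π^tp_X)^ell)`
  have hmem : ((z * b * z⁻¹ * b⁻¹ : C.Huu) : D.PiTemp) ∈ (D.thetaToEll.comp D.toTheta).ker := by
    rw [D.ker_toEll, Subgroup.mem_comap]
    apply Subgroup.le_topologicalClosure
    simp only [Subgroup.coe_mul, Subgroup.coe_inv, map_mul, map_inv]
    have hz' : D.toHat.toMonoidHom (z : D.PiTemp) ∈ D.DeltaHat :=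
      Subgroup.le_topologicalClosure _ ⟨_, hz, rfl⟩
    have hb' : D.toHat.toMonoidHom (b : D.PiTemp) ∈ D.DeltaHat :=
      Subgroup.le_topologicalClosure _ ⟨_, hb, rfl⟩
    rw [← commutatorElement_def]
    exact Subgroup.commutator_mem_commutator hz' hb'
  rw [MonoidHom.mem_ker, MonoidHom.coe_comp, Function.comp_apply] at hmem
  exact hmem

end EtaleThetaData.DoubleUnderline

end ThetaSetting

end Literature.AnabelianGeometry.EtaleTheta

end
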